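import Mathlib
import Summits.ValiantsHypothesis.ValiantsHypothesis.Theses.LiftNullstellensatz
import Summits.ValiantsHypothesis.ValiantsHypothesis.Theorems.LiftNullstellensatzDetReprLiftTensorTrain
import Summits.ValiantsHypothesis.ValiantsHypothesis.Theorems.LiftNullstellensatzDetReprLiftLeVerrier
import Summits.ValiantsHypothesis.ValiantsHypothesis.Theorems.LiftNullstellensatzDetReprLiftCounter
import Literature.Computability.AlgebraicComplexity.DeterminantalConormalBoundKernelAlgebra

/-!
# Item `DetReprLift` (stmt-ValiantsHypothesis-5924) of route `LiftNullstellensatz`: proof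

`Summit.ValiantsHypothesis.ValiantsHypothesis.Theses.LiftNullstellensatz.DetReprLift` with `d = 3`:
every form `f ∈ ℂ[x_σ]` (`σ` finite), homogeneous of degree `N`, with an affine determinantal
representation `f = det A` of size `m` has a word lift `Ψ : (Fin N → σ) → ℂ`
(`Σ_w Ψ(w) · X_{w 0} ⋯ X_{w (N-1)} = f`) all of whose sequential flattenings have rank
`≤ (m² + 1)(m + 1) ≤ (m + 2)³` — i.e. `f` has a homogeneous algebraic branching program of that
width (Nisan 1991; determinant programs: LeVerrier/Csanky, Berkowitz 1984, Mahajan–Vinay 1997).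

## Proof (files `LiftNullstellensatzDetReprLift{TensorTrain,LeVerrier,Counter}.lean`)

Write `-A = B⁰ + Σ_s X_s B¹_s` (affine entries).  The LeVerrier tensor train
(`lvLayer`, `lvVec_card_dotProduct`; it rests on the PROVED Faddeev–LeVerrier recursion of
`Literature/LinearAlgebra/Matrix/FaddeevLeVerrier.lean`) writes `det A = det (−(−A))` as
`e ⬝ 𝒯_0 ⋯ 𝒯_{m-1} ⬝ e` for `m` affine layers `𝒯_t = lvLayer κ_t (−A)` of width `m² + 1`,
`κ_t = −1/(t+1)`; by linearity of `lvLayer` these are affine layers with constant parts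
`lvLayer κ_t B⁰` and linear parts `lvLayer κ_t B¹_s`.  The counter construction
(`homogeneousComponent_symbVec_dotProduct`, `symbW_eq_vecMul_pow`) computes the degree-`N`
component of such a product by a UNIFORM tensor train on `(m² + 1)(m + 1)` states, and the
tensor-train lemmas (`sum_ttWord_smul_prod`, `rank_flattening_ttWord_le`) turn it into a word
tensor with the displayed commutative image and cut ranks `≤ #states`.  Finally
`hc_N (det A) = hc_N f = f`.

No named facts are used; axioms are the standard three.
-/

namespace Summit.ValiantsHypothesis.ValiantsHypothesis.Theorems

-- the single-problem summit's namespace `Summit.ValiantsHypothesis.ValiantsHypothesis` repeats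
set_option linter.dupNamespace false

open Matrix MvPolynomial DetReprLift Literature.Computability.AlgebraicComplexity

/-- **Core construction.** For an `m × m` matrix `A` of affine linear forms over `ℂ[x_σ]` and any
`N`, the degree-`N` homogeneous component of `det A` is the commutative image of the word tensor of
a uniform tensor train on the state type `Option (Fin m × Fin m) × Fin (m + 1)` (LeVerrier train,
homogenised by the layer counter). [folklore] -/
theorem exists_ttWord_homogeneousComponent_det {σ : Type} [Fintype σ] [DecidableEq σ] {m : ℕ}
    (A : Matrix (Fin m) (Fin m) (MvPolynomial σ ℂ)) (hA : ∀ i j, (A i j).totalDegree ≤ 1)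
    (N : ℕ) :
    ∃ (α : Option (Fin m × Fin m) × Fin (m + 1) → ℂ)
      (U : σ → Matrix (Option (Fin m × Fin m) × Fin (m + 1))
        (Option (Fin m × Fin m) × Fin (m + 1)) ℂ)
      (β : Option (Fin m × Fin m) × Fin (m + 1) → ℂ),
      (∑ w : Fin N → σ, ttWord α U β w • ∏ t, (X (w t) : MvPolynomial σ ℂ)) =
        homogeneousComponent N A.det := by
  -- affine decomposition of `B := -A`
  set B : Matrix (Fin m) (Fin m) (MvPolynomial σ ℂ) := -A with hB
  have hBdeg : ∀ i j, (B i j).totalDegree ≤ 1 := fun i j => by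
    rw [hB, Matrix.neg_apply, totalDegree_neg]; exact hA i j
  set B0 : Matrix (Fin m) (Fin m) ℂ := B.map (coeff 0) with hB0
  set B1 : σ → Matrix (Fin m) (Fin m) ℂ := fun s => B.map (coeff (Finsupp.single s 1)) with hB1
  have hBaff : B = B0.map C + ∑ s, (X s : MvPolynomial σ ℂ) • (B1 s).map C := by
    refine Matrix.ext fun i j => ?_
    simp only [Matrix.add_apply, Matrix.map_apply, Matrix.sum_apply, Matrix.smul_apply,
      smul_eq_mul, hB0, hB1]
    conv_lhs => rw [DeterminantalConormal.eq_C_add_sum_of_totalDegree_le_one (hBdeg i j)]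
    congr 1
    refine Finset.sum_congr rfl fun s _ => ?_
    exact mul_comm _ _
  -- LeVerrier data: closing weights `κ_t = -1/(t+1)` and the constant / linear parts of the layers
  set κ' : ℕ → ℂ := fun t => -((t : ℂ) + 1)⁻¹ with hκ'
  set T0 : ℕ → Matrix (Option (Fin m × Fin m)) (Option (Fin m × Fin m)) ℂ :=
    fun t => lvLayer (κ' t) B0 with hT0
  set T1 : ℕ → σ → Matrix (Option (Fin m × Fin m)) (Option (Fin m × Fin m)) ℂ :=
    fun t s => lvLayer (κ' t) (B1 s) with hT1
  -- the symbolic LeVerrier layers of `B` are the affine layers of `(T0, T1)`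
  have hlayer : ∀ t, lvLayer (C (κ' t)) B = symbLayer T0 T1 t := by
    intro t
    rw [hBaff, lvLayer_add, lvLayer_sum, symbLayer]
    congr 1
    · exact (lvLayer_map C (κ' t) B0).symm
    · refine Finset.sum_congr rfl fun s _ => ?_
      rw [lvLayer_smul, lvLayer_map]
  have hvec : ∀ t, lvVec (fun t => C (κ' t)) B t =
      symbVec (Pi.single none 1 : Option (Fin m × Fin m) → ℂ) T0 T1 t := by
    intro t
    induction t with
    | zero =>
      funext x
      rcases x with _ | x <;> simp
    | succ t ih => rw [lvVec_succ, symbVec_succ, ih, hlayer]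
  have hκ : ∀ t < Fintype.card (Fin m), ((t : MvPolynomial σ ℂ) + 1) * C (κ' t) = -1 := by
    intro t _
    have h : ((t : ℂ) + 1) ≠ 0 := Nat.cast_add_one_ne_zero t
    rw [hκ', show ((t : MvPolynomial σ ℂ) + 1) = C ((t : ℂ) + 1) by
      rw [map_add, map_natCast, map_one], ← map_mul, mul_neg, mul_inv_cancel₀ h, map_neg, map_one]
  -- `det A` through the LeVerrier train
  have hdet : (symbVec (Pi.single none 1 : Option (Fin m × Fin m) → ℂ) T0 T1 m ⬝ᵥ fun x =>
      C ((Pi.single none 1 : Option (Fin m × Fin m) → ℂ) x)) = A.det := by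
    have h1 := lvVec_card_dotProduct (fun t => C (κ' t)) B hκ
    rw [Fintype.card_fin, hvec, hB, neg_neg] at h1
    have hvecC : (fun x => C ((Pi.single none 1 : Option (Fin m × Fin m) → ℂ) x)) =
        (Pi.single none 1 : Option (Fin m × Fin m) → MvPolynomial σ ℂ) := by
      funext x
      rcases x with _ | x <;> simp
    rw [hvecC]
    exact h1
  -- the counter train lifts `hc_N (det A)`
  refine ⟨cα (Pi.single none 1) m, cU T0 T1 m, cβ T0 (Pi.single none 1) m, ?_⟩
  have key := sum_ttWord_smul_prod (A := MvPolynomial σ ℂ) (cα (Pi.single none 1 :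
    Option (Fin m × Fin m) → ℂ) m) (cU T0 T1 m) (cβ T0 (Pi.single none 1) m) X N
  rw [algebraMap_eq] at key
  simp only [smul_eq_C_mul] at key
  simp only [smul_eq_C_mul]
  rw [key, dotProduct_mulVec, ← hdet, homogeneousComponent_symbVec_dotProduct, symbW_eq_vecMul_pow,
    symbU]
  rfl

/-- A crude size bound: `(m² + 1)(m + 1) ≤ (m + 2)³`. [folklore] -/
theorem card_states_le (m : ℕ) : (m * m + 1) * (m + 1) ≤ (m + 2) ^ 3 := by
  have h1 : m * m + 1 ≤ (m + 2) * (m + 2) := by nlinarith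
  calc (m * m + 1) * (m + 1) ≤ (m + 2) * (m + 2) * (m + 2) :=
        Nat.mul_le_mul h1 (Nat.le_succ _)
    _ = (m + 2) ^ 3 := by ring

/-- **Item `DetReprLift` (stmt-ValiantsHypothesis-5924), proved with `d = 3`.** Every form that is
homogeneous of degree `N` and has an affine determinantal representation of size `m` admits a word
lift of length `N` all of whose sequential flattenings have rank `≤ (m + 2) ^ 3` — a homogeneous
algebraic branching program of width `(m² + 1)(m + 1)`: the LeVerrier determinant program,
substituted and homogenised (Nisan 1991; Berkowitz 1984; Mahajan–Vinay 1997). [folklore] -/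
theorem detReprLift_proof :
    Summit.ValiantsHypothesis.ValiantsHypothesis.Theses.LiftNullstellensatz.DetReprLift := by
  refine ⟨3, ?_⟩
  intro σ _ N m f hf hdr
  classical
  obtain ⟨A, hA, hdetA⟩ := hdr
  obtain ⟨α, U, β, hΨ⟩ := exists_ttWord_homogeneousComponent_det A hA N
  refine ⟨ttWord α U β, ?_, fun k l h => ?_⟩
  · rw [hΨ, hdetA, homogeneousComponent_eq_self hf]
  · refine (rank_flattening_ttWord_le α U β k l h).trans ?_
    simp only [Fintype.card_prod, Fintype.card_option, Fintype.card_fin]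
    exact card_states_le m

end Summit.ValiantsHypothesis.ValiantsHypothesis.Theorems
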